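import Literature.Geometry.Kaehler.CyclotomicCMTypesDegreeEightHodgeConjecture
import Literature.AlgebraicGeometry.Pohlmann1968.NonSimpleCMAbelianVarietyHazamaCriterion
import Literature.AlgebraicGeometry.Pohlmann1968.CMTypeRankLowerBoundsNumberField
import Literature.AlgebraicGeometry.ComplexMultiplication.CyclotomicCMTypeIsogenyClasses
import Literature.NumberTheory.ComplexMultiplication.CMTypeInducedFromPrimitive
import HarnessLib

/-!
# EVERY abelian variety with complex multiplication by a cyclotomic field of degree `8` — of ANY CM type, primitive or not —
# has `B•(Aⁿ) ⊗ ℂ = D•(Aⁿ) ⊗ ℂ` and satisfies the Hodge conjecture with all its powers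

Layer `Literature/Geometry/Kaehler`, namespace `Literature.Geometry.Kaehler.ComplexTorus`; lane `lit-hodgefound` (Track 2 foundations
library), prover seat `lit-hodgefound-p10`, generation 33, row «A2-26(hh)» (self-proposed 2026-08-28) — the variety-side summit of the
generation.  Theorems only; no `def`, no instance, no named fact (net Literature debt 0).

THE ARGUMENT (uniform in the type).  Let `K = ℚ(ζ_d)`, `φ(d) = 8`, `Φ` a CM type of `K`, `A ⊨ (K; Φ)`.  If `Φ` is primitive, `Rank(Φ) = 5`
(this generation's per-field certificates, `CyclotomicCMTypesDegreeEightHodgeConjecture`) and Pohlmann–White–Hazama give `B•(Aⁿ) = D•(Aⁿ)`.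
If not, let `(K₁, Φ₁)` be the primitive sub-pair inducing `Φ` (Streng I.3.5, tree `exists_primitive_inducedCMType_eq_of_isCMField`);
Koblitz–Rohrlich: `[K : K₁] = |W(S_Φ)| ≥ 2` (tree `finrank_eq_card_filter_of_primitive`; `W ≠ {1}` because `Φ` is not primitive,
`isPrimitive_iff_hasTrivialStabilizer`), so `[K₁ : ℚ] ≤ 4`, and a PRIMITIVE type of a CM field of degree `≤ 6` is NONDEGENERATE
(Ribet–Lenstra–Dodson bound, tree `isNondegenerate_of_isPrimitive_of_finrank_le_six`); Hazama's criterion for `A ≅ B^h` on the algebraic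
carrier (tree `IsNondegenerate.hodgeClassSpan_pow_eq_divisorClassesSpan_inducedCMType`) gives `B•(Aⁿ) ⊗ ℂ = D•(Aⁿ) ⊗ ℂ` for all `n`;
Lefschetz `(1,1)` and cup products make divisor power classes algebraic.

* **`hodgeClassSpan_pow_eq_divisorClassesSpan_of_totient_eq_eight`**: `Bᵐ(Aⁿ) ⊗ ℂ = Dᵐ(Aⁿ) ⊗ ℂ` for all `n, m`, EVERY CM type of `ℚ(ζ_d)`,
  `φ(d) = 8`, every realisation.
* **`hodgeConjectureFor_pow_of_totient_eq_eight`**: the Hodge conjecture for EVERY power of EVERY abelian variety with complex multiplication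
  by (the full ring of integers of, through a CM type of) a cyclotomic field of degree `8`; `hodgeConjectureFor_of_totient_eq_eight` (the
  variety itself, spelling `A.dim`: `dim A = 4`, `Bᵐ(A) ⊗ ℂ = Dᵐ(A) ⊗ ℂ`, `HodgeConjectureFor A.dim A.X` — through Hazama's intrinsic form for
  abelian CM fields, tree `forall_pow_hodgeClassSpan_eq_iff_forall_hodgeClassSpan_eq`).
* `not_exists_exceptional_pow_of_totient_eq_eight`: no power of such an `A` carries an exceptional Hodge class.

## References

* [Gordon1999HodgeAVSurvey] B. B. Gordon, *A survey of the Hodge conjecture for abelian varieties* (1999), Thm. 6.4 (Hazama–Murty), §9.3.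
* [Hazama2003CyclicCM] F. Hazama, *Hodge cycles on abelian varieties with complex multiplication by cyclic CM-fields*, J. Math. Sci.
  Univ. Tokyo 10 (2003), p. 582.
* [Dodson1984] B. Dodson, *The structure of Galois groups of CM-fields*, Trans. AMS 283 (1984), §3.3.2 Theorem p. 16.
* [KoblitzRohrlich1978] N. Koblitz, D. Rohrlich, *Simple factors in the Jacobian of a Fermat curve*, Canad. J. Math. 30 (1978), §1 p. 1184.
* [Streng2010] M. Streng, *Complex multiplication of abelian surfaces*, PhD thesis, Leiden (2010), Ch. I Lemma 3.5.
* [Shimura1998] G. Shimura, *Abelian Varieties with Complex Multiplication and Modular Functions* (1998), §6.2 Thm. 3, §8.2 Prop. 26.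
-/

noncomputable section

open scoped Classical nonZeroDivisors NumberField
open NumberField Module CategoryTheory CategoryTheory.Limits

namespace Literature.Geometry.Kaehler

namespace ComplexTorus

-- `open scoped`: the tree's action of `Aut(ℂ)` on `Hom(K, ℂ)` by composition (`ringEquivCompAction`) is a scoped instance
open scoped Literature.NumberTheory.ComplexMultiplication
open Literature.AlgebraicGeometry.Motives (CMType AbelianVariety)
open Literature.AlgebraicGeometry.HodgeTheory (HodgeConjectureFor complexBetti IsRationalClass IsOfHodgeType algebraicClasses)
open Literature.AlgebraicGeometry.VanGeemen1994 (hodgeClassSpan)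
open Literature.Barriers.HodgeConjecture (divisorClassesSpan)
open Literature.NumberTheory.ComplexMultiplication (IsPrimitive inducedCMType exists_primitive_inducedCMType_eq_of_isCMField)
open Literature.AlgebraicGeometry.Pohlmann1968 (IsNondegenerate isNondegenerate_of_isPrimitive_of_finrank_le_six)
open Literature.AlgebraicGeometry.ComplexMultiplication (IsCMTypeRealisation isPrimitive_ringEquiv_complex_iff
  finrank_eq_card_filter_of_primitive one_mem_stabilizerResidues)
open Literature.AlgebraicGeometry.ComplexMultiplication.CyclotomicCMTypeResidueSets (unitResidues residueSet HasTrivialStabilizer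
  isPrimitive_iff_hasTrivialStabilizer)

variable {d : ℕ} {K : Type} [Field K] [NumberField K]
  {A : AbelianVariety ℂ} {ι : 𝓞 K →+* End A} {θ : K →+* Module.End ℂ (complexBetti A.X 1)}

/-- `Bᵐ ⊗ ℂ = Dᵐ ⊗ ℂ` for all `m` on an abelian variety `B` gives the Hodge conjecture for `B` (Lefschetz `(1,1)` and cup products:
divisor power classes are algebraic; Hodge models exist for smooth projective varieties — all theorems of the tree).
[cite: Gordon1999HodgeAVSurvey, §9.3] -/
private theorem hodgeConjectureFor_of_forall_hodgeClassSpan_eq₄₃ (B : AbelianVariety ℂ)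
    (h : ∀ m : ℕ, hodgeClassSpan B.dim B.X m = divisorClassesSpan B.X B.dim m) : HodgeConjectureFor B.dim B.X :=
  ⟨Literature.AlgebraicGeometry.HodgeTheory.nonempty_hodgeModel_holds
      (Literature.AlgebraicGeometry.Motives.AbelianVariety.isSmoothProjective_holds (A := B)),
    fun m _ hc hmm ↦ Literature.AlgebraicGeometry.HodgeTheory.AbelianVariety.divisorClassesSpan_le_algebraicClasses B
      (fun b hb hb' ↦ Literature.AlgebraicGeometry.HodgeTheory.lefschetzOneOne_rational_holds
        (Literature.AlgebraicGeometry.Motives.AbelianVariety.isSmoothProjective_holds (A := B)) b hb hb') m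
      ((h m) ▸ Submodule.subset_span ⟨hc, hmm⟩)⟩

/-- **`Bᵐ(Aⁿ) ⊗ ℂ = Dᵐ(Aⁿ) ⊗ ℂ` FOR ALL `n, m`, FOR EVERY CM TYPE OF EVERY CYCLOTOMIC FIELD OF DEGREE `8` AND EVERY REALISATION** —
primitive types by their rank `5`, imprimitive ones through their primitive sub-pair `(K₁, Φ₁)`, `[K₁ : ℚ] ≤ 4`, which is nondegenerate,
and Hazama's criterion for `A ≅ B^h`. [cite: Gordon1999HodgeAVSurvey, Thm. 6.4 and §9.3] [cite: Hazama2003CyclicCM, p. 582]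
[cite: KoblitzRohrlich1978, §1 p. 1184] [cite: Streng2010, Ch. I Lemma 3.5] [cite: Dodson1984, §3.3.2 Theorem (p. 16)] -/
theorem hodgeClassSpan_pow_eq_divisorClassesSpan_of_totient_eq_eight (hK : IsCyclotomicExtension {d} ℚ K) (h8 : Nat.totient d = 8)
    (Φ : CMType K) (hA : IsCMTypeRealisation Φ A ι θ) (n m : ℕ) :
    hodgeClassSpan (⨁ fun _ : Fin n => A).dim (⨁ fun _ : Fin n => A).X m =
      divisorClassesSpan (⨁ fun _ : Fin n => A).X (⨁ fun _ : Fin n => A).dim m := by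
  have hd2 : 2 < d := by
    by_contra hle
    interval_cases d <;> simp_all
  haveI : NeZero d := ⟨by omega⟩
  haveI : IsCMField K := IsCyclotomicExtension.Rat.isCMField K (S := ({d} : Set ℕ)) ⟨d, rfl, hd2⟩
  obtain ⟨φ₀⟩ : Nonempty (K →+* ℂ) := inferInstance
  by_cases hΦ : IsPrimitive (ℂ ≃+* ℂ) Φ.1 φ₀
  · exact (isSimple_and_hodgeConjectureFor_pow_of_isPrimitive_of_totient_eq_eight hK h8 Φ φ₀ hΦ hA n m).2.1
  -- the primitive sub-pair `(K₁, Φ₁)` of an imprimitive type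
  obtain ⟨K₁, Φ₁, hCM, h₁, hp₁, -⟩ := exists_primitive_inducedCMType_eq_of_isCMField Φ
  haveI := hCM
  -- `[K : K₁] = |W| ≥ 2`
  have hW := finrank_eq_card_filter_of_primitive (N := d) Φ Φ₁ h₁ hp₁
  have hnt : ¬ HasTrivialStabilizer d (residueSet d Φ) := fun h ↦ hΦ ((isPrimitive_iff_hasTrivialStabilizer d Φ φ₀).2 h)
  have h2 : 2 ≤ Module.finrank K₁ K := by
    rw [hW]
    simp only [HasTrivialStabilizer, not_forall] at hnt
    obtain ⟨t, ht, hstab, ht1⟩ := hnt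
    have h1mem := one_mem_stabilizerResidues (N := d) Φ
    have htmem : t ∈ (unitResidues d).filter
        (fun t => ∀ c ∈ unitResidues d, (c * t ∈ residueSet d Φ ↔ c ∈ residueSet d Φ)) :=
      Finset.mem_filter.2 ⟨ht, hstab⟩
    calc 2 = ({1, t} : Finset (ZMod d)).card := by rw [Finset.card_pair (Ne.symm ht1)]
      _ ≤ _ := Finset.card_le_card (by
          intro x hx
          simp only [Finset.mem_insert, Finset.mem_singleton] at hx
          rcases hx with rfl | rfl
          exacts [h1mem, htmem])
  -- `[K₁ : ℚ] ≤ 4 ≤ 6`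
  have hmul : Module.finrank ℚ K₁ * Module.finrank K₁ K = 8 := by
    rw [Module.finrank_mul_finrank, IsCyclotomicExtension.Rat.finrank d K, h8]
  have hK₁ : Module.finrank ℚ K₁ ≤ 6 := by
    have h : Module.finrank ℚ K₁ * 2 ≤ 8 := hmul ▸ Nat.mul_le_mul_left _ h2
    omega
  -- `Φ₁` is primitive, hence nondegenerate; Hazama's criterion
  obtain ⟨s₀⟩ : Nonempty (K₁ →+* ℂ) := inferInstance
  have hp : IsPrimitive (ℂ ≃+* ℂ) Φ₁.1 s₀ := (isPrimitive_ringEquiv_complex_iff Φ₁ s₀).2 hp₁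
  have hnd : IsNondegenerate Φ₁ := isNondegenerate_of_isPrimitive_of_finrank_le_six Φ₁ hK₁ s₀ hp
  exact hnd.hodgeClassSpan_pow_eq_divisorClassesSpan_inducedCMType h₁ hA n m

/-- **THE HODGE CONJECTURE FOR EVERY POWER OF EVERY ABELIAN VARIETY WITH COMPLEX MULTIPLICATION BY A CYCLOTOMIC FIELD OF DEGREE `8`**
(`A` realising any CM type `Φ` of `ℚ(ζ_d)`, `φ(d) = 8` — `ℚ(ζ₁₅) = ℚ(ζ₃₀)`, `ℚ(ζ₁₆)`, `ℚ(ζ₂₀)`, `ℚ(ζ₂₄)` —, every `n`), UNCONDITIONALLY.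
[cite: Gordon1999HodgeAVSurvey, Thm. 6.4 and §9.3] [cite: Hazama2003CyclicCM, p. 582] [cite: Dodson1984, §3.3.2 Theorem (p. 16)] -/
theorem hodgeConjectureFor_pow_of_totient_eq_eight (hK : IsCyclotomicExtension {d} ℚ K) (h8 : Nat.totient d = 8) (Φ : CMType K)
    (hA : IsCMTypeRealisation Φ A ι θ) (n : ℕ) :
    HodgeConjectureFor (⨁ fun _ : Fin n => A).dim (⨁ fun _ : Fin n => A).X :=
  hodgeConjectureFor_of_forall_hodgeClassSpan_eq₄₃ _
    (fun m ↦ hodgeClassSpan_pow_eq_divisorClassesSpan_of_totient_eq_eight hK h8 Φ hA n m)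

/-- **No power of an abelian variety with complex multiplication by a cyclotomic field of degree `8` carries an exceptional Hodge class.**
[cite: Gordon1999HodgeAVSurvey, Thm. 6.4] [cite: Hazama2003CyclicCM, p. 582] -/
theorem not_exists_exceptional_pow_of_totient_eq_eight (hK : IsCyclotomicExtension {d} ℚ K) (h8 : Nat.totient d = 8) (Φ : CMType K)
    (hA : IsCMTypeRealisation Φ A ι θ) (n m : ℕ) :
    ¬ ∃ c : complexBetti (⨁ fun _ : Fin n => A).X (2 * m), IsRationalClass c ∧
        IsOfHodgeType (⨁ fun _ : Fin n => A).dim (⨁ fun _ : Fin n => A).X (2 * m) m m c ∧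
        c ∉ divisorClassesSpan (⨁ fun _ : Fin n => A).X (⨁ fun _ : Fin n => A).dim m := by
  rintro ⟨c, hcQ, hcH, hcD⟩
  exact hcD ((hodgeClassSpan_pow_eq_divisorClassesSpan_of_totient_eq_eight hK h8 Φ hA n m) ▸ Submodule.subset_span ⟨hcQ, hcH⟩)

/-- **The Hodge conjecture for every abelian variety with complex multiplication by a cyclotomic field of degree `8`** (`n = 1`, spelling
`A.dim`; `dim A = 4`). [cite: Gordon1999HodgeAVSurvey, Thm. 6.4 and §9.3] [cite: Hazama2003CyclicCM, p. 582] -/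
theorem hodgeConjectureFor_of_totient_eq_eight (hK : IsCyclotomicExtension {d} ℚ K) (h8 : Nat.totient d = 8) (Φ : CMType K)
    (hA : IsCMTypeRealisation Φ A ι θ) :
    A.dim = 4 ∧ (∀ m : ℕ, hodgeClassSpan A.dim A.X m = divisorClassesSpan A.X A.dim m) ∧ HodgeConjectureFor A.dim A.X := by
  have hd2 : 2 < d := by
    by_contra hle
    interval_cases d <;> simp_all
  haveI : NeZero d := ⟨by omega⟩
  haveI : IsCMField K := IsCyclotomicExtension.Rat.isCMField K (S := ({d} : Set ℕ)) ⟨d, rfl, hd2⟩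
  haveI : IsAbelianGalois ℚ K := IsCyclotomicExtension.isAbelianGalois {d} ℚ K
  have hd : A.dim = Module.finrank ℚ K / 2 := Literature.AlgebraicGeometry.Motives.schemeDim_eq_holds hA.1
  have hall : ∀ m : ℕ, hodgeClassSpan A.dim A.X m = divisorClassesSpan A.X A.dim m := by
    rw [hd]
    exact (Literature.AlgebraicGeometry.Pohlmann1968.forall_pow_hodgeClassSpan_eq_iff_forall_hodgeClassSpan_eq hA).1
      (fun n m ↦ hodgeClassSpan_pow_eq_divisorClassesSpan_of_totient_eq_eight hK h8 Φ hA n m)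
  exact ⟨dim_eq_four_of_isCMTypeRealisation_of_totient_eq_eight hK h8 hA, hall,
    hodgeConjectureFor_of_forall_hodgeClassSpan_eq₄₃ A hall⟩

end ComplexTorus

end Literature.Geometry.Kaehler

end
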